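import Summits.Ventures.GridStability.Models.StructurePreserving
import Literature.MathematicalPhysics.PowerSystems.StructurePreservingModel

/-!
# GridStability/Models/StructurePreservingBridge — the two typings of Bergen–Hill agree

LADDER-GRIDFUSION rung G3, seat gridfusion-model-2; `plan/PARTITION.md` amendment A12 addendum
(2026-08-26T18:12Z): the structure-preserving model [cite: BergenHill1981] as printed in
[cite: Padiyar2013, §3.2 eqs (3.1)–(3.14)] has two typings in the tree —
`Literature.MathematicalPhysics.PowerSystems.BergenHill` (lit-2, the AS-PRINTED statement layer)
and `Summit.Ventures.GridStability.Models.StructurePreserving.Params` (model-2, the instance /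
proof / polynomialisation layer). This file is the bridge the cell asked for («BergenHill ↦ Params,
flow = pe, energy = energy»), so that downstream files (Bench certificates, Lyapunov bridges,
MODEL-VALIDITY row MV-3 / MV-ω citations) may use either vocabulary and transport results.

## What is proved (all definitional up to `ring` / reindexing)
* `Params.ofBergenHill S gen` / `Params.toBergenHill p` — the two records carry the same data
  (`M, D, P⁰, b`); the Summits record additionally NAMES the generator set `gen` (Padiyar's
  `i = 1, …, m`), which the Literature record leaves implicit in the sign pattern of `M`;
  `toBergenHill_ofBergenHill`, `ofBergenHill_toBergenHill` (round trips).
* `ofBergenHill_pe : (ofBergenHill S gen).pe = S.flow` (Padiyar (3.2)/(3.9): the nodal injection),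
  `ofBergenHill_syncFreq` (ω₀, (3.3)), `ofBergenHill_Pbar` (P̄, (3.5)), `ofBergenHill_shifted`
  (rotating frame (3.4)–(3.5)), `isSyncEquilibrium_iff` (s.e.p. of the shifted system, (3.12)).
* `bergenHill_branchEnergy` / `ofBergenHill_potential` / `ofBergenHill_kinetic` /
  `ofBergenHill_energy`: the two typings of the topological Lyapunov function (3.11)–(3.14) are
  the SAME real number — the kinetic parts agree once `Mᵢ = 0` off `gen` (printed: `Mᵢ = 0` at
  load buses), which is exactly why Padiyar may write `½ ω_gᵀ M_g ω_g` over generators only.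
* `isSolution_of_isSolutionAt` / `isSolutionAt_of_isSolution`: solution notions correspond
  (the Literature notion asks the bus frequency to be differentiable at load buses too — a
  regularity convention, supplied as the hypothesis `hreg` in the converse direction).
* `wellFormed_iff`: the Summits sign pattern `WellFormed` is the printed one, phrased with the
  Literature predicates `IsGeneratorNode` / `IsLoadBus`.

MODELLED (three columns): everything here is about the mathematical model of MODEL-VALIDITY row
MV-3 (lossless lines, `|V| ≡ 1`, frequency-dependent active load, classical machines); nothing is
claimed about any grid. No new physics, no new named fact: a dictionary between two files.
-/

noncomputable section

open Finset

namespace Summit.Ventures.GridStability.Models.StructurePreserving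

open Literature.MathematicalPhysics.PowerSystems (BergenHill)

variable {n : ℕ}

namespace Params

/-- The Summits parameter record built from the Literature (as-printed) Bergen–Hill record `S`
and a choice of generator set `gen` (Padiyar's nodes `1, …, m`; the Literature record encodes it
only through `Mᵢ > 0` vs `Mᵢ = 0`). Same `M, D, P⁰, b`. [cite: Padiyar2013, §3.2 eq (3.2)].
MODELLED: MODEL-VALIDITY row MV-3. -/
def ofBergenHill (S : BergenHill n) (gen : Finset (Fin n)) : Params n :=
  ⟨S.M, S.D, S.P0, S.b, gen⟩

/-- Forgetting the generator set: the Literature record underlying a Summits record. -/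
def toBergenHill (p : Params n) : BergenHill n :=
  ⟨p.M, p.D, p.P0, p.b⟩

/-- Same inertia constants `Mᵢ`. -/
@[simp] theorem ofBergenHill_M (S : BergenHill n) (gen : Finset (Fin n)) :
    (ofBergenHill S gen).M = S.M := rfl

/-- Same damping / load-frequency coefficients `Dᵢ`. -/
@[simp] theorem ofBergenHill_D (S : BergenHill n) (gen : Finset (Fin n)) :
    (ofBergenHill S gen).D = S.D := rfl

/-- Same net injections `P⁰ᵢ`. -/
@[simp] theorem ofBergenHill_P0 (S : BergenHill n) (gen : Finset (Fin n)) :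
    (ofBergenHill S gen).P0 = S.P0 := rfl

/-- Same couplings `bᵢⱼ`. -/
@[simp] theorem ofBergenHill_b (S : BergenHill n) (gen : Finset (Fin n)) :
    (ofBergenHill S gen).b = S.b := rfl

/-- The declared generator set. -/
@[simp] theorem ofBergenHill_gen (S : BergenHill n) (gen : Finset (Fin n)) :
    (ofBergenHill S gen).gen = gen := rfl

/-- Same inertia constants `Mᵢ` (Summits → Literature). -/
@[simp] theorem toBergenHill_M (p : Params n) : p.toBergenHill.M = p.M := rfl

/-- Same coefficients `Dᵢ` (Summits → Literature). -/
@[simp] theorem toBergenHill_D (p : Params n) : p.toBergenHill.D = p.D := rfl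

/-- Same net injections `P⁰ᵢ` (Summits → Literature). -/
@[simp] theorem toBergenHill_P0 (p : Params n) : p.toBergenHill.P0 = p.P0 := rfl

/-- Same couplings `bᵢⱼ` (Summits → Literature). -/
@[simp] theorem toBergenHill_b (p : Params n) : p.toBergenHill.b = p.b := rfl

/-- Round trip Literature → Summits → Literature is the identity. -/
@[simp] theorem toBergenHill_ofBergenHill (S : BergenHill n) (gen : Finset (Fin n)) :
    (ofBergenHill S gen).toBergenHill = S := rfl

/-- Round trip Summits → Literature → Summits recovers the record once its own `gen` is supplied. -/
@[simp] theorem ofBergenHill_toBergenHill (p : Params n) :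
    ofBergenHill p.toBergenHill p.gen = p := rfl

/-- **flow = pe**: the nodal injection `Σⱼ bᵢⱼ sin(δᵢ − δⱼ)` is the same function in both typings
[cite: Padiyar2013, §3.2 eqs (3.2), (3.9)]. -/
@[simp] theorem ofBergenHill_pe (S : BergenHill n) (gen : Finset (Fin n)) :
    (ofBergenHill S gen).pe = S.flow := rfl

/-- Same statement read from the Summits side. -/
@[simp] theorem toBergenHill_flow (p : Params n) : p.toBergenHill.flow = p.pe := rfl

/-- The equilibrium frequency `ω₀ = Σ P⁰ᵢ / Σ Dᵢ` agrees [cite: Padiyar2013, §3.2 eq (3.3)]. -/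
@[simp] theorem ofBergenHill_syncFreq (S : BergenHill n) (gen : Finset (Fin n)) :
    (ofBergenHill S gen).syncFreq = S.syncFrequency := rfl

/-- The shifted injections `P̄ᵢ = P⁰ᵢ − Dᵢ ω₀` agree [cite: Padiyar2013, §3.2 eq (3.5)]. -/
@[simp] theorem ofBergenHill_Pbar (S : BergenHill n) (gen : Finset (Fin n)) :
    (ofBergenHill S gen).Pbar = S.shiftedInjection := rfl

/-- The rotating-frame records agree: shifting commutes with the bridge
[cite: Padiyar2013, §3.2 eqs (3.4)–(3.5)]. -/
@[simp] theorem ofBergenHill_shifted (S : BergenHill n) (gen : Finset (Fin n)) :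
    (ofBergenHill S gen).shifted = ofBergenHill S.shifted gen := rfl

/-- Synchronous equilibria of the Summits typing are exactly the angle equilibria of the
Literature SHIFTED system (`flow δ₀ = P̄`), i.e. the s.e.p. `α₀` of (3.11)–(3.12)
[cite: Padiyar2013, §3.2 eq (3.12), Remark 1]. -/
theorem isSyncEquilibrium_iff (S : BergenHill n) (gen : Finset (Fin n)) (δ₀ : Fin n → ℝ) :
    (ofBergenHill S gen).IsSyncEquilibrium δ₀ ↔ S.shifted.IsEquilibrium δ₀ := Iff.rfl

/-- When the injections already balance (`ω₀ = 0`, e.g. `Σ P⁰ᵢ = 0`), the Literature equilibria of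
the UNshifted system are the Summits synchronous equilibria. -/
theorem isSyncEquilibrium_iff_of_syncFrequency_eq_zero (S : BergenHill n) (gen : Finset (Fin n))
    (h0 : S.syncFrequency = 0) (δ₀ : Fin n → ℝ) :
    (ofBergenHill S gen).IsSyncEquilibrium δ₀ ↔ S.IsEquilibrium δ₀ := by
  simp only [IsSyncEquilibrium, BergenHill.IsEquilibrium, ofBergenHill_pe, ofBergenHill_Pbar,
    BergenHill.shiftedInjection, h0, mul_zero, sub_zero]

/-- The printed sign pattern, in either vocabulary: `WellFormed (ofBergenHill S gen)` says every
node of `gen` is a generator node (`Mᵢ > 0`), every other node is a load bus (`Mᵢ = 0`),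
`Dᵢ > 0` everywhere and `b` is symmetric [cite: Padiyar2013, §3.2, display under eq (3.2)]. -/
theorem wellFormed_iff (S : BergenHill n) (gen : Finset (Fin n)) :
    (ofBergenHill S gen).WellFormed ↔
      (∀ i ∈ gen, S.IsGeneratorNode i) ∧ (∀ i, i ∉ gen → S.IsLoadBus i) ∧
        (∀ i, 0 < S.D i) ∧ (∀ i j, S.b i j = S.b j i) :=
  ⟨fun h => ⟨h.M_pos, h.M_eq_zero, h.D_pos, h.b_symm⟩,
    fun h => ⟨h.1, h.2.1, h.2.2.1, h.2.2.2⟩⟩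

/-! ## energy = energy -/

/-- The two closed forms of the branch integral `∫_{σ₀}^{σ} (sin β − sin σ₀) dβ` differ only in
where the coefficient `b` sits: `BergenHill.branchEnergy b σ₀ σ = b · branchEnergy σ σ₀`
[cite: Padiyar2013, §3.2 eq (3.13)]. -/
theorem bergenHill_branchEnergy (b σ₀ σ : ℝ) :
    BergenHill.branchEnergy b σ₀ σ = b * branchEnergy σ σ₀ := by
  unfold BergenHill.branchEnergy branchEnergy
  ring

/-- **Potential energies agree** (`W(δ, δ₀)` of (3.12)–(3.13), half the double sum over ordered
bus pairs in both files) [cite: Padiyar2013, §3.2 eqs (3.12)–(3.13)]. -/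
@[simp] theorem ofBergenHill_potential (S : BergenHill n) (gen : Finset (Fin n))
    (δ₀ δ : Fin n → ℝ) :
    (ofBergenHill S gen).potential δ₀ δ = S.potentialEnergy δ₀ δ := by
  unfold potential BergenHill.potentialEnergy
  simp only [ofBergenHill_b, bergenHill_branchEnergy]

/-- **Kinetic energies agree once `Mᵢ = 0` off the generator set** — the Literature file sums
`½ Mᵢ vᵢ²` over all nodes, the Summits file over `gen` only; the printed `Mᵢ = 0` at load buses
makes them equal [cite: Padiyar2013, §3.2 eqs (3.11), (3.14) and the display under (3.2)]. -/
theorem ofBergenHill_kinetic (S : BergenHill n) {gen : Finset (Fin n)}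
    (hM : ∀ i, i ∉ gen → S.M i = 0) (v : Fin n → ℝ) :
    (ofBergenHill S gen).kinetic v = S.kineticEnergy v := by
  unfold kinetic BergenHill.kineticEnergy
  have h : ∑ i ∈ gen, S.M i * v i ^ 2 = ∑ i, S.M i * v i ^ 2 := by
    apply Finset.sum_subset (Finset.subset_univ _)
    intro i _ hi
    simp [hM i hi]
  rw [ofBergenHill_M, ofBergenHill_gen, h, Finset.mul_sum]
  refine Finset.sum_congr rfl fun i _ => ?_
  ring

/-- **energy = energy**: Bergen–Hill's topological Lyapunov function `V = ½ ω_gᵀ M_g ω_g + W(α, α₀)`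
[cite: Padiyar2013, §3.2 eq (3.11)] is the same real number in both typings (for data with the
printed `Mᵢ = 0` at load buses). Consequently every statement either file proves about its `V`
(dissipation identity `dV/dt = −Σ Dᵢ δ̇ᵢ²`, bounds of `StructurePreservingEnergy`) transports. -/
theorem ofBergenHill_energy (S : BergenHill n) {gen : Finset (Fin n)}
    (hM : ∀ i, i ∉ gen → S.M i = 0) (δ₀ δ v : Fin n → ℝ) :
    (ofBergenHill S gen).energy δ₀ δ v = S.energy δ₀ δ v := by
  unfold energy BergenHill.energy
  rw [ofBergenHill_kinetic S hM, ofBergenHill_potential]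

/-- The same with the Summits record as the primary object (well-formed data). -/
theorem energy_eq_toBergenHill_energy {p : Params n} (hp : p.WellFormed) (δ₀ δ v : Fin n → ℝ) :
    p.energy δ₀ δ v = p.toBergenHill.energy δ₀ δ v := by
  have h := ofBergenHill_energy p.toBergenHill (gen := p.gen) hp.M_eq_zero δ₀ δ v
  rwa [ofBergenHill_toBergenHill] at h

/-! ## solutions correspond -/

/-- Literature solutions are Summits solutions: if `(δ, v)` solves (3.2) at every time in the
sense of `BergenHill.IsSolutionAt` (velocities `v`, some accelerations), then the angle
trajectory `δ` is an `IsSolution` of the Summits typing (for ANY declared generator set), and `v`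
is its derivative [cite: Padiyar2013, §3.2 eq (3.2)]. -/
theorem isSolution_of_isSolutionAt (S : BergenHill n) (gen : Finset (Fin n))
    {δ v : ℝ → Fin n → ℝ} (h : ∀ t, S.IsSolutionAt δ v t) :
    (ofBergenHill S gen).IsSolution δ ∧ ∀ t i, deriv (fun s => δ s i) t = v t i := by
  have hδ : ∀ t i, HasDerivAt (fun s => δ s i) (v t i) t := fun t i => by
    obtain ⟨_, h1, _, _⟩ := h t i
    exact h1
  have hderiv : ∀ i, deriv (fun s => δ s i) = fun t => v t i := fun i => by
    funext t; exact (hδ t i).deriv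
  refine ⟨⟨fun i t => (hδ t i).differentiableAt, fun i _ t => ?_, fun t i => ?_⟩,
    fun t i => (hδ t i).deriv⟩
  · obtain ⟨a, _, h2, _⟩ := h t i
    rw [hderiv i]
    exact h2.differentiableAt
  · obtain ⟨a, _, h2, h3⟩ := h t i
    rw [hderiv i, h2.deriv]
    simpa using h3

/-- Summits solutions are Literature solutions, with velocities `δ̇` and accelerations `δ̈`,
provided the bus frequencies are differentiable at the load buses as well (`hreg`; at generator
nodes this is part of `IsSolution`) — the Literature notion builds that regularity convention in
[cite: Padiyar2013, §3.2 eq (3.2)]. -/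
theorem isSolutionAt_of_isSolution (S : BergenHill n) {gen : Finset (Fin n)}
    {δ : ℝ → Fin n → ℝ} (h : (ofBergenHill S gen).IsSolution δ)
    (hreg : ∀ i, i ∉ gen → Differentiable ℝ (deriv fun t => δ t i)) (t : ℝ) :
    S.IsSolutionAt δ (fun s i => deriv (fun u => δ u i) s) t := by
  intro i
  have hd2 : Differentiable ℝ (deriv fun u => δ u i) := by
    by_cases hi : i ∈ gen
    · exact h.differentiable_deriv i hi
    · exact hreg i hi
  refine ⟨deriv (deriv fun u => δ u i) t, ((h.differentiable i) t).hasDerivAt,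
    (hd2 t).hasDerivAt, ?_⟩
  simpa using h.swing t i

/-- Transport example (the point of the bridge): Bergen–Hill's dissipation identity for a
Literature record, obtained from the Summits theorem `hasDerivAt_energy` through the dictionary —
along every Literature solution of the SHIFTED system (3.4)–(3.5) about an s.e.p. `δ₀`,
`dV/dt = −Σᵢ Dᵢ vᵢ²` [cite: Padiyar2013, §3.2 eqs (3.10)–(3.14)]. (The Literature file proves the
same identity directly as `BergenHill.hasDerivAt_energy`; this version shows the two developments
are interchangeable, which is what PARTITION A12 records.) -/
theorem hasDerivAt_energy_ofBergenHill (S : BergenHill n) {gen : Finset (Fin n)}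
    (hp : (ofBergenHill S gen).WellFormed) {δ₀ : Fin n → ℝ} (h₀ : S.shifted.IsEquilibrium δ₀)
    {δ v : ℝ → Fin n → ℝ} (hsol : ∀ t, S.shifted.IsSolutionAt δ v t) (t : ℝ) :
    HasDerivAt (fun s => S.energy δ₀ (δ s) (v s)) (-∑ i, S.D i * v t i ^ 2) t := by
  obtain ⟨hS, hv⟩ := isSolution_of_isSolutionAt S.shifted gen hsol
  have h := hasDerivAt_energy hp ((isSyncEquilibrium_iff S gen δ₀).2 h₀)
    (by simpa only [ofBergenHill_shifted] using hS) t
  have hfun : (fun s => (ofBergenHill S gen).energy δ₀ (δ s) fun i => deriv (fun u => δ u i) s)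
      = fun s => S.energy δ₀ (δ s) (v s) := by
    funext s
    have hM : ∀ i, i ∉ gen → S.M i = 0 := hp.M_eq_zero
    rw [ofBergenHill_energy S hM]
    congr 1
    funext i
    exact hv s i
  rw [hfun] at h
  simpa only [ofBergenHill_D, hv] using h

end Params

end Summit.Ventures.GridStability.Models.StructurePreserving

end
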